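import Mathlib
import HarnessLib
import Summits.KontsevichZagierPeriods.KontsevichZagierPeriods.Theorems.MzvKernelInKZTwoPosetsCubicalChart
import Summits.KontsevichZagierPeriods.KontsevichZagierPeriods.Theorems.LinRedNormalFormDihedralNormalFormStubAtomReductionAux1

/-!
# Stub `stub_atomReduction`, tools II: order sectors of the cube and their nested charts

Registered sub-goal of this file: `stub_atomReduction_sectorCover`.

For a permutation `π` of the coordinates, the open order sector
`Sec_π = {v ∈ (0,1)ᵏ | v_{π 0} > v_{π 1} > ⋯ > v_{π (k-1)}}` is the image of the open ordered
simplex under the coordinate permutation `t ↦ t ∘ π⁻¹`, hence (cubical chart `tⱼ = y₀ ⋯ yⱼ` of the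
simplex, `MzvKernelInKZ.TwoPosets.image_cubicalMap`) of the open cube under the *nested chart*
`v_{π j} = y₀ y₁ ⋯ yⱼ`, whose Jacobian is `∏ⱼ yⱼ^{k-1-j}`:

* `integrableOn_sector_iff` — `F` is integrable on `Sec_π` iff `(F ∘ chart) · Jacobian` is
  integrable on the open cube (Mathlib's Jacobian change of variables);
* `integrableOn_cube_of_forall_sector` — the sectors cover the cube up to the null set of ties,
  so integrability on every sector gives integrability on the cube;
* `prod_pprod_pow`, `prod_pprod_zpow`, `eq_of_forall_sum_filter_le_eq` — exponent bookkeeping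
  along the nested chart (powers of the partial products `y₀ ⋯ yⱼ` regrouped by variable; the
  upper partial sums determine a sequence).

Recurring terms are written through parse-time notations (`CP⟪⟫`, `ATOM⟪⟫`, `SEC⟪⟫`, `NC⟪⟫`,
`CHORD⟪⟫`, `WEIGHT⟪⟫`, `EXPL⟪⟫`, `CPOLY⟪⟫`, `DIAG⟪⟫`, …); the files introduce no definitions.
-/

noncomputable section

open MeasureTheory Set MvPolynomial Filter Topology

namespace Summit.KontsevichZagierPeriods.DihedralNormalForm.TorusDescent.AtomReduction

open Summit.KontsevichZagierPeriods.MzvKernelInKZ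
open Summit.KontsevichZagierPeriods.FurushoPentagon.HoffmanRelationInKZ
  (hasFDerivAt_monomialChart det_monomialChart)

/-! ### Notation (parse-time abbreviations; no definitions are introduced) -/

set_option quotPrecheck false

local notation "SEC⟪" k ", " π "⟫" =>
  ({v : Fin k → ℝ | (∀ i, v i ∈ Set.Ioo (0:ℝ) 1) ∧ StrictAnti fun j => v (π j)} : Set (Fin k → ℝ))
local notation "NC⟪" k ", " π ", " y "⟫" =>
  (Summit.KontsevichZagierPeriods.MzvKernelInKZ.TwoPosets.cubicalMap k y ∘ (Equiv.symm π))
local notation "EXPL⟪" π ", " ν "⟫" =>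
  (Finsupp.equivFunOnFinite.symm fun i => ∑ j ∈ Finset.univ.filter (fun j => i ≤ j), ν (π j))

set_option quotPrecheck true

variable {k : ℕ}

/-! ### The cube and the simplex of the tree -/

/-- The tree's open cube `TwoPosets.cube` is the open unit cube `{x | ∀ i, x i ∈ (0,1)}`. -/
theorem twoPosets_cube_eq (k : ℕ) :
    TwoPosets.cube k = {x : Fin k → ℝ | ∀ i, x i ∈ Ioo (0:ℝ) 1} := rfl

/-- **The cubical chart of the simplex transports integrability**: `H` is integrable on the open
ordered simplex iff `(H ∘ cubicalMap) · ∏ⱼ yⱼ^{k-1-j}` is integrable on the open cube. -/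
theorem integrableOn_simplex_iff (k : ℕ) (H : (Fin k → ℝ) → ℝ) :
    IntegrableOn H (Negative.simplex k) ↔
      IntegrableOn (fun y => H (TwoPosets.cubicalMap k y) * ∏ j, y j ^ (k - 1 - (j : ℕ)))
        {x : Fin k → ℝ | ∀ i, x i ∈ Ioo (0:ℝ) 1} := by
  have hS : ∀ i : Fin k, ∀ j ∈ Finset.univ.filter (fun j => j ≤ i), j ≤ i := fun i j hj =>
    (Finset.mem_filter.mp hj).2
  have hS' : ∀ i : Fin k, i ∈ Finset.univ.filter (fun j => j ≤ i) := fun i =>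
    Finset.mem_filter.mpr ⟨Finset.mem_univ _, le_rfl⟩
  have hderiv := fun y : Fin k → ℝ =>
    hasFDerivAt_monomialChart (fun i : Fin k => Finset.univ.filter (fun j => j ≤ i)) y
  have hdet := det_monomialChart (fun i : Fin k => Finset.univ.filter (fun j => j ≤ i)) hS hS'
  have hinj : InjOn (fun (y : Fin k → ℝ) (i : Fin k) => ∏ j ∈ Finset.univ.filter (fun j => j ≤ i), y j)
      {x : Fin k → ℝ | ∀ i, x i ∈ Ioo (0:ℝ) 1} := TwoPosets.injOn_cubicalMap k
  rw [← TwoPosets.image_cubicalMap k, twoPosets_cube_eq,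
    show TwoPosets.cubicalMap k = fun y i => ∏ j ∈ Finset.univ.filter (fun j => j ≤ i), y j
      from rfl]
  rw [integrableOn_image_iff_integrableOn_abs_det_fderiv_smul volume (measurableSet_cube k)
    (fun y _ => (hderiv y).hasFDerivWithinAt) hinj H]
  refine integrableOn_congr_fun (fun y hy => ?_) (measurableSet_cube k)
  rw [hdet, TwoPosets.prod_prod_erase_filter_le, abs_of_pos (TwoPosets.jacobian_pos hy),
    smul_eq_mul, mul_comm]

/-! ### Order sectors -/

/-- The coordinate permutation `t ↦ t ∘ π⁻¹`, evaluated. -/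
theorem piCongrLeft_perm_apply (π : Equiv.Perm (Fin k)) (t : Fin k → ℝ) (l : Fin k) :
    MeasurableEquiv.piCongrLeft (fun _ => ℝ) π t l = t (π.symm l) := by
  have h := MeasurableEquiv.piCongrLeft_apply_apply π (β := fun _ => ℝ) t (π.symm l)
  rwa [Equiv.apply_symm_apply] at h

/-- A sector is the image of the open ordered simplex under a coordinate permutation. -/
theorem sector_eq_image (π : Equiv.Perm (Fin k)) :
    SEC⟪k, π⟫ = MeasurableEquiv.piCongrLeft (fun _ => ℝ) π '' Negative.simplex k := by
  ext v
  constructor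
  · rintro ⟨hv, hanti⟩
    refine ⟨fun j => v (π j), ⟨fun j => (hv _).1, fun j => (hv _).2, hanti⟩, ?_⟩
    funext l
    rw [piCongrLeft_perm_apply, Equiv.apply_symm_apply]
  · rintro ⟨t, ⟨h0, h1, hanti⟩, rfl⟩
    refine ⟨fun l => ?_, fun a b hab => ?_⟩
    · rw [piCongrLeft_perm_apply]
      exact ⟨h0 _, h1 _⟩
    · simp only [piCongrLeft_perm_apply, Equiv.symm_apply_apply]
      exact hanti hab

/-- The nested chart `y ↦ cubicalMap y ∘ π⁻¹` of the sector of `π`, evaluated at `π j`: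
`v (π j) = y₀ y₁ ⋯ yⱼ`. -/
theorem nestedChart_apply_perm (π : Equiv.Perm (Fin k)) (y : Fin k → ℝ) (j : Fin k) :
    NC⟪k, π, y⟫ (π j) = ∏ i ∈ Finset.univ.filter (fun i => i ≤ j), y i := by
  simp [TwoPosets.cubicalMap, TwoPosets.pprod]

/-- **Integrability on a sector through the nested chart.** `F` is integrable on the sector of
`π` iff `(F ∘ nestedChart π) · ∏ⱼ yⱼ^{k-1-j}` is integrable on the open cube. -/
theorem integrableOn_sector_iff (π : Equiv.Perm (Fin k)) (F : (Fin k → ℝ) → ℝ) :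
    IntegrableOn F (SEC⟪k, π⟫) ↔
      IntegrableOn (fun y => F (NC⟪k, π, y⟫) * ∏ j, y j ^ (k - 1 - (j : ℕ)))
        {x : Fin k → ℝ | ∀ i, x i ∈ Ioo (0:ℝ) 1} := by
  rw [sector_eq_image, (volume_measurePreserving_piCongrLeft (fun _ => ℝ) π).integrableOn_image
    (MeasurableEquiv.measurableEmbedding _), integrableOn_simplex_iff]
  refine integrableOn_congr_fun (fun y _ => ?_) (measurableSet_cube k)
  simp only [Function.comp_apply]
  congr 2
  funext l
  exact piCongrLeft_perm_apply π _ l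

/-- The hyperplane `{v | v i = v j}` (`i ≠ j`) is Lebesgue-null. -/
theorem volume_setOf_apply_eq_apply {i j : Fin k} (hij : i ≠ j) :
    volume {v : Fin k → ℝ | v i = v j} = 0 := by
  let L : (Fin k → ℝ) →ₗ[ℝ] ℝ :=
    LinearMap.proj (R := ℝ) (φ := fun _ : Fin k => ℝ) i -
      LinearMap.proj (R := ℝ) (φ := fun _ : Fin k => ℝ) j
  have hker : {v : Fin k → ℝ | v i = v j} = (LinearMap.ker L : Set (Fin k → ℝ)) := by
    ext v
    simp [L, sub_eq_zero]
  rw [hker]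
  refine Measure.addHaar_submodule volume _ fun htop => ?_
  have hmem : (Pi.single i (1:ℝ) : Fin k → ℝ) ∈ LinearMap.ker L := by
    rw [htop]; trivial
  simp [L, Pi.single_eq_of_ne hij.symm] at hmem

/-- The set of points of `ℝᵏ` with two equal coordinates is Lebesgue-null. -/
theorem volume_setOf_not_injective (k : ℕ) :
    volume {v : Fin k → ℝ | ¬ Function.Injective v} = 0 := by
  have hsub : {v : Fin k → ℝ | ¬ Function.Injective v} ⊆
      ⋃ p : {p : Fin k × Fin k // p.1 ≠ p.2}, {v | v p.1.1 = v p.1.2} := by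
    intro v hv
    simp only [mem_setOf_eq, Function.Injective, not_forall] at hv
    obtain ⟨a, b, hab, hne⟩ := hv
    exact mem_iUnion.2 ⟨⟨(a, b), hne⟩, hab⟩
  refine measure_mono_null hsub ?_
  exact (measure_iUnion_null_iff).2 fun p => volume_setOf_apply_eq_apply p.2

/-- Every point of the cube with pairwise distinct coordinates lies in some sector (sort the
coordinates). -/
theorem exists_mem_sector {v : Fin k → ℝ} (hv : ∀ i, v i ∈ Ioo (0:ℝ) 1)
    (hinj : Function.Injective v) : ∃ π : Equiv.Perm (Fin k), v ∈ SEC⟪k, π⟫ := by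
  set σ := Tuple.sort v with hσ
  have hsm : StrictMono (v ∘ σ) :=
    (Tuple.monotone_sort v).strictMono_of_injective (hinj.comp σ.injective)
  refine ⟨Fin.revPerm.trans σ, hv, fun a b hab => ?_⟩
  show v (σ (Fin.rev b)) < v (σ (Fin.rev a))
  exact hsm (Fin.rev_strictAnti hab)

/-- **The sectors cover the cube up to a null set**: integrability on every sector gives
integrability on the open cube. -/
theorem integrableOn_cube_of_forall_sector (F : (Fin k → ℝ) → ℝ)
    (h : ∀ π : Equiv.Perm (Fin k), IntegrableOn F (SEC⟪k, π⟫)) :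
    IntegrableOn F {x : Fin k → ℝ | ∀ i, x i ∈ Ioo (0:ℝ) 1} := by
  have hcover : {x : Fin k → ℝ | ∀ i, x i ∈ Ioo (0:ℝ) 1} ⊆
      {v | ¬ Function.Injective v} ∪ ⋃ π : Equiv.Perm (Fin k), SEC⟪k, π⟫ := by
    intro v hv
    by_cases hinj : Function.Injective v
    · exact Or.inr (mem_iUnion.2 (exists_mem_sector hv hinj))
    · exact Or.inl hinj
  refine IntegrableOn.mono_set ?_ hcover
  exact (integrableOn_of_volume_eq_zero F (volume_setOf_not_injective k)).union
    (integrableOn_finite_iUnion.2 h)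

/-- Integrability on the cube restricts to every sector. -/
theorem integrableOn_sector_of_cube {F : (Fin k → ℝ) → ℝ}
    (h : IntegrableOn F {x : Fin k → ℝ | ∀ i, x i ∈ Ioo (0:ℝ) 1}) (π : Equiv.Perm (Fin k)) :
    IntegrableOn F (SEC⟪k, π⟫) :=
  h.mono_set fun _ hv => hv.1

/-- The nested chart is measurable. -/
theorem measurable_nestedChart (π : Equiv.Perm (Fin k)) : Measurable fun y : Fin k → ℝ => NC⟪k, π, y⟫ := by
  refine measurable_pi_iff.2 fun l => ?_
  simp only [Function.comp_apply, TwoPosets.cubicalMap, TwoPosets.pprod]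
  exact Finset.measurable_prod _ fun i _ => measurable_pi_apply i

/-- The nested chart maps the open cube into the sector of `π`. -/
theorem nestedChart_mem_sector (π : Equiv.Perm (Fin k)) {y : Fin k → ℝ}
    (hy : ∀ i, y i ∈ Ioo (0:ℝ) 1) : NC⟪k, π, y⟫ ∈ SEC⟪k, π⟫ := by
  rw [sector_eq_image]
  refine ⟨TwoPosets.cubicalMap k y, ?_, ?_⟩
  · rw [← TwoPosets.image_cubicalMap k]
    exact mem_image_of_mem _ hy
  · funext l
    rw [piCongrLeft_perm_apply]
    rfl

/-! ### Exponent bookkeeping along the nested chart -/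

section Exponents

variable {k : ℕ}

/-- Integer powers of a non-zero base turn sums of exponents into products. -/
theorem zpow_finset_sum {ι : Type*} (s : Finset ι) (f : ι → ℤ) {x : ℝ} (hx : x ≠ 0) :
    x ^ (∑ a ∈ s, f a) = ∏ a ∈ s, x ^ f a := by
  classical
  induction s using Finset.induction_on with
  | empty => simp
  | insert a s ha ih => rw [Finset.sum_insert ha, Finset.prod_insert ha, zpow_add₀ hx, ih]

/-- Powers of the partial products `y₀ ⋯ yⱼ` regrouped by variable:
`∏ⱼ (y₀⋯yⱼ)^{νⱼ} = ∏ᵢ yᵢ^{∑_{j ≥ i} νⱼ}`. -/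
theorem prod_pprod_pow (ν : Fin k → ℕ) (y : Fin k → ℝ) :
    ∏ j, (∏ i ∈ Finset.univ.filter (fun i => i ≤ j), y i) ^ ν j =
      ∏ i, y i ^ (∑ j ∈ Finset.univ.filter (fun j => i ≤ j), ν j) := by
  calc ∏ j, (∏ i ∈ Finset.univ.filter (fun i => i ≤ j), y i) ^ ν j
      = ∏ j, ∏ i, if i ≤ j then y i ^ ν j else 1 := by
        refine Finset.prod_congr rfl fun j _ => ?_
        rw [← Finset.prod_pow, Finset.prod_filter]
    _ = ∏ i, ∏ j, if i ≤ j then y i ^ ν j else 1 := Finset.prod_comm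
    _ = ∏ i, y i ^ (∑ j ∈ Finset.univ.filter (fun j => i ≤ j), ν j) := by
        refine Finset.prod_congr rfl fun i _ => ?_
        rw [← Finset.prod_filter, Finset.prod_pow_eq_pow_sum]

/-- Integer powers of partial products regrouped by variable:
`∏ₐ (y₀⋯y_{J a})^{γₐ} = ∏ᵢ yᵢ^{∑_{a : J a ≥ i} γₐ}` (non-zero `y`). -/
theorem prod_pprod_zpow {ι : Type*} [Fintype ι] (J : ι → Fin k) (γ : ι → ℤ) (y : Fin k → ℝ)
    (hy : ∀ i, y i ≠ 0) :
    ∏ a, (∏ i ∈ Finset.univ.filter (fun i => i ≤ J a), y i) ^ γ a =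
      ∏ i, y i ^ (∑ a ∈ Finset.univ.filter (fun a => i ≤ J a), γ a) := by
  calc ∏ a, (∏ i ∈ Finset.univ.filter (fun i => i ≤ J a), y i) ^ γ a
      = ∏ a, ∏ i, if i ≤ J a then y i ^ γ a else 1 := by
        refine Finset.prod_congr rfl fun a _ => ?_
        rw [← Finset.prod_zpow, Finset.prod_filter]
    _ = ∏ i, ∏ a, if i ≤ J a then y i ^ γ a else 1 := Finset.prod_comm
    _ = ∏ i, y i ^ (∑ a ∈ Finset.univ.filter (fun a => i ≤ J a), γ a) := by
        refine Finset.prod_congr rfl fun i _ => ?_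
        rw [← Finset.prod_filter, zpow_finset_sum _ _ (hy i)]

/-- Upper partial sums determine the sequence: if `∑_{j ≥ i} f j = ∑_{j ≥ i} g j` for all `i`
then `f = g`. -/
theorem eq_of_forall_sum_filter_le_eq {f g : Fin k → ℕ}
    (h : ∀ i, ∑ j ∈ Finset.univ.filter (fun j => i ≤ j), f j =
      ∑ j ∈ Finset.univ.filter (fun j => i ≤ j), g j) : f = g := by
  funext i
  induction hm : k - 1 - (i : ℕ) using Nat.strong_induction_on generalizing i with
  | _ m ih =>
    have hsplit : ∀ u : Fin k → ℕ, ∑ j ∈ Finset.univ.filter (fun j => i ≤ j), u j =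
        u i + ∑ j ∈ Finset.univ.filter (fun j => i < j), u j := by
      intro u
      rw [Finset.sum_filter, Finset.sum_filter]
      have : ∀ j, (if i ≤ j then u j else 0) = (if j = i then u j else 0) +
          (if i < j then u j else 0) := by
        intro j
        rcases lt_trichotomy i j with hij | rfl | hij
        · rw [if_pos hij.le, if_neg hij.ne', if_pos hij, zero_add]
        · simp
        · rw [if_neg (not_le.2 hij), if_neg hij.ne, if_neg (not_lt.2 hij.le)]
      rw [Finset.sum_congr rfl fun j _ => this j, Finset.sum_add_distrib, Finset.sum_ite_eq']
      simp
    have htail : ∑ j ∈ Finset.univ.filter (fun j => i < j), f j =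
        ∑ j ∈ Finset.univ.filter (fun j => i < j), g j := by
      refine Finset.sum_congr rfl fun j hj => ?_
      have hij : i < j := (Finset.mem_filter.1 hj).2
      have hjk : (j : ℕ) < k := j.isLt
      exact ih (k - 1 - (j : ℕ)) (by have := Fin.lt_def.1 hij; omega) j rfl
    have := h i
    rw [hsplit f, hsplit g, htail] at this
    omega

end Exponents




/-- **Registered sub-goal `stub_atomReduction_sectorCover`** (tools II): integrability on every order
sector of the open cube gives integrability on the cube. -/
theorem stub_atomReduction_sectorCover : ∀ (k : ℕ) (F : (Fin k → ℝ) → ℝ), (∀ π : Equiv.Perm (Fin k), MeasureTheory.IntegrableOn F {v : Fin k → ℝ | (∀ i, v i ∈ Set.Ioo (0:ℝ) 1) ∧ StrictAnti fun j => v (π j)} MeasureTheory.volume) → MeasureTheory.IntegrableOn F {x : Fin k → ℝ | ∀ i, x i ∈ Set.Ioo (0:ℝ) 1} MeasureTheory.volume :=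
  fun _ F h => integrableOn_cube_of_forall_sector F h

end Summit.KontsevichZagierPeriods.DihedralNormalForm.TorusDescent.AtomReduction
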